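import Summits.Ventures.LatticeQCDFlow.Scoring.UNWilsonLoopSecondMoment2D
import Summits.Ventures.LatticeQCDFlow.Scoring.SUNOnePlaquetteTwoPoint
import Summits.Ventures.LatticeQCDFlow.TrivializingMaps.HaarTraceMomentsSUn
import HarnessLib

/-!
# The exact second moment of two-dimensional `SU(N)` Wilson loops: `⟨|tr W_{R×T}|²⟩_β = 1 + (N² − 1)·P_adj(β)^{RT}`

HONEST FRAMING: exact (Metropolis-corrected) sampling algorithms for lattice gauge theory;
figures of merit are autocorrelation/cost numbers at stated couplings and volumes; no
continuum-physics claim.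

Venture `LatticeQCDFlow` (cell pub-lqcd), sub-topic `Scoring`; FANOUT row 5 (`s0-sun-a`), GEN-21.
NEW WORK of the cell (placement rule).  The `SU(N)` twin of `UNWilsonLoopSecondMoment2D` (`N ≥ 2`, every
real `β`, free-boundary `R × T` lattice realised in `(ℤ/L)²`, `R + 1 ≤ L`, `T + 1 ≤ L`, weight
`e^{−β(N − Re tr U_p)}`):

  **`⟨|tr W_{R×T}|²⟩_β = 1 + (N² − 1)·P_adj(β)^{RT}`**, `P_adj(β) = (M₂/D − 1)/(N² − 1)`,

now with the `SU(N)` one-plaquette data `D = Σ_{q∈ℤ} det[I_{|q+i−j|}(β)]_{N×N} = ∫_{SU(N)} e^{βRe tr u} du`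
(GEN-17's Bars–Green series) and `M₂ = ∫_{SU(N)} |tr u|² e^{βRe tr u} du`.  For `SU(2)` the trace is real, so
this is the full second moment `⟨(tr W)²⟩_β` and, with GEN-18's first moment `⟨½tr W⟩_β = P₂(β)^{RT}`
(`P₂ = I₂(2β)/I₁(2β)`), the exact variance of the measured loop: `Var_β(½tr W_{R×T}) =
¼(1 + 3·P_adj(β)^{RT}) − P₂(β)^{2RT}`.  Inputs: §1 of the `U(N)` file (channel-matrix algebra), GEN-20's
`SUNOnePlaquetteTwoPoint` (the `SU(N)` one-plaquette channel `S(X) = A·X + B·tr(X)·1`, Schur's lemma in `SU(N)`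
form), GEN-21's Kronecker area law (`NonabelianAreaLaw2DWilsonLoop` §5) and GEN-18's `SU(N)` partition function.

* §1 `specialUnitary_kroneckerConj_integral_eq_channel`, **`specialUnitary_trace_kroneckerConj_integral_pow`**
  (`tr Mⁿ = Dⁿ + (N² − 1)Aⁿ` for the `SU(N)` one-plaquette Kronecker matrix);
* §2 `specialUnitary_open_normSq_trace_wilsonLoop_integral_eq`, **`specialUnitary_open_normSq_trace_wilsonLoop_eq`**.

No `def`, nothing cited as a fact, 0 sorry.
-/

noncomputable section

open MeasureTheory Function Finset
open Literature.MathematicalPhysics.QuantumFieldTheory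
open Literature.MathematicalPhysics.QuantumLattice
open Summit.Ventures.LatticeQCDFlow.Theory2.Lattice
open Summit.Ventures.LatticeQCDFlow.Theory2.Lattice.TwoDim
open Literature.Analysis.FunctionSpaces (besselI)
open scoped Kronecker

namespace Summit.Ventures.LatticeQCDFlow.Scoring

/-! ## §1. The one-plaquette Kronecker matrix of `SU(N)` is the matrix of the `SU(N)` channel -/

section OnePlaquette

variable {N : ℕ}

/-- **The `SU(N)` one-plaquette Kronecker matrix is the channel matrix** (`N ≥ 2`):
`∫_{SU(N)} (u ⊗ₖ ū)_{(a,b),(c,d)} e^{βRe tr u} du = A·(E_{cd})_{ab} + B·tr(E_{cd})·δ_{ab}`,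
`A = (M₂ − D)/(N² − 1)`, `B = (D − A)/N` (GEN-20 `integral_specialUnitary_conj_entry_mul_exp`). -/
theorem specialUnitary_kroneckerConj_integral_eq_channel (hN : 2 ≤ N) (β : ℝ) (k l : Fin N × Fin N) :
    ∫ u, (((u : Matrix.specialUnitaryGroup (Fin N) ℂ) : Matrix (Fin N) (Fin N) ℂ) ⊗ₖ
        (((u : Matrix.specialUnitaryGroup (Fin N) ℂ) : Matrix (Fin N) (Fin N) ℂ).map (starRingEnd ℂ))) k l *
        (Real.exp (β * ((u : Matrix.specialUnitaryGroup (Fin N) ℂ) : Matrix (Fin N) (Fin N) ℂ).trace.re) : ℂ)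
        ∂(haarProbability (Matrix.specialUnitaryGroup (Fin N) ℂ)) =
      ((((∫ u, (‖((u : Matrix.specialUnitaryGroup (Fin N) ℂ) : Matrix (Fin N) (Fin N) ℂ).trace‖ ^ 2 : ℝ) *
          Real.exp (β * ((u : Matrix.specialUnitaryGroup (Fin N) ℂ) : Matrix (Fin N) (Fin N) ℂ).trace.re)
          ∂(haarProbability (Matrix.specialUnitaryGroup (Fin N) ℂ))) -
          (∑' q : ℤ, (Matrix.of fun i j : Fin N => besselI (q + (i : ℤ) - (j : ℤ)).natAbs β).det)) /
            ((N : ℝ) ^ 2 - 1) : ℝ) : ℂ) * Matrix.single l.1 l.2 (1 : ℂ) k.1 k.2 +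
        ((((∑' q : ℤ, (Matrix.of fun i j : Fin N => besselI (q + (i : ℤ) - (j : ℤ)).natAbs β).det) -
          ((∫ u, (‖((u : Matrix.specialUnitaryGroup (Fin N) ℂ) : Matrix (Fin N) (Fin N) ℂ).trace‖ ^ 2 : ℝ) *
            Real.exp (β * ((u : Matrix.specialUnitaryGroup (Fin N) ℂ) : Matrix (Fin N) (Fin N) ℂ).trace.re)
            ∂(haarProbability (Matrix.specialUnitaryGroup (Fin N) ℂ))) -
            (∑' q : ℤ, (Matrix.of fun i j : Fin N => besselI (q + (i : ℤ) - (j : ℤ)).natAbs β).det)) /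
            ((N : ℝ) ^ 2 - 1)) / N : ℝ) : ℂ) *
          ((Matrix.single l.1 l.2 (1 : ℂ)).trace * (1 : Matrix (Fin N) (Fin N) ℂ) k.1 k.2) := by
  simp_rw [kronecker_conj_apply]
  exact integral_specialUnitary_conj_entry_mul_exp hN β (Matrix.single l.1 l.2 1) k.1 k.2

/-- **`tr Mⁿ = Dⁿ + (N² − 1)·Aⁿ`** for the `SU(N)` one-plaquette Kronecker matrix
`M_{(a,b),(c,d)} = ∫_{SU(N)} (u ⊗ₖ ū)_{(a,b),(c,d)} e^{βRe tr u} du`, `N ≥ 2`, with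
`D = Σ_q det[I_{|q+i−j|}(β)]`, `A = (M₂ − D)/(N² − 1)`, `M₂ = ∫_{SU(N)} |tr u|² e^{βRe tr u} du`. -/
theorem specialUnitary_trace_kroneckerConj_integral_pow (hN : 2 ≤ N) (β : ℝ) (n : ℕ) :
    ((Matrix.of fun k l : Fin N × Fin N => ∫ u, (((u : Matrix.specialUnitaryGroup (Fin N) ℂ) : Matrix (Fin N) (Fin N) ℂ) ⊗ₖ
        (((u : Matrix.specialUnitaryGroup (Fin N) ℂ) : Matrix (Fin N) (Fin N) ℂ).map (starRingEnd ℂ))) k l *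
        (Real.exp (β * ((u : Matrix.specialUnitaryGroup (Fin N) ℂ) : Matrix (Fin N) (Fin N) ℂ).trace.re) : ℂ)
        ∂(haarProbability (Matrix.specialUnitaryGroup (Fin N) ℂ))) ^ n).trace =
      ((∑' q : ℤ, (Matrix.of fun i j : Fin N => besselI (q + (i : ℤ) - (j : ℤ)).natAbs β).det : ℝ) : ℂ) ^ n +
        ((N : ℂ) ^ 2 - 1) *
          ((((∫ u, (‖((u : Matrix.specialUnitaryGroup (Fin N) ℂ) : Matrix (Fin N) (Fin N) ℂ).trace‖ ^ 2 : ℝ) *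
              Real.exp (β * ((u : Matrix.specialUnitaryGroup (Fin N) ℂ) : Matrix (Fin N) (Fin N) ℂ).trace.re)
              ∂(haarProbability (Matrix.specialUnitaryGroup (Fin N) ℂ))) -
              (∑' q : ℤ, (Matrix.of fun i j : Fin N => besselI (q + (i : ℤ) - (j : ℤ)).natAbs β).det)) /
              ((N : ℝ) ^ 2 - 1) : ℝ) : ℂ) ^ n := by
  haveI : NeZero N := ⟨by omega⟩
  set M₂ : ℝ := ∫ u, (‖((u : Matrix.specialUnitaryGroup (Fin N) ℂ) : Matrix (Fin N) (Fin N) ℂ).trace‖ ^ 2 : ℝ) *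
    Real.exp (β * ((u : Matrix.specialUnitaryGroup (Fin N) ℂ) : Matrix (Fin N) (Fin N) ℂ).trace.re)
    ∂(haarProbability (Matrix.specialUnitaryGroup (Fin N) ℂ)) with hM₂
  set D : ℝ := ∑' q : ℤ, (Matrix.of fun i j : Fin N => besselI (q + (i : ℤ) - (j : ℤ)).natAbs β).det with hD
  set A : ℂ := (((M₂ - D) / ((N : ℝ) ^ 2 - 1) : ℝ) : ℂ) with hA
  set B : ℂ := (((D - (M₂ - D) / ((N : ℝ) ^ 2 - 1)) / N : ℝ) : ℂ) with hB
  have hS : ∀ k l : Fin N × Fin N, (∫ u, (((u : Matrix.specialUnitaryGroup (Fin N) ℂ) : Matrix (Fin N) (Fin N) ℂ) ⊗ₖ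
        (((u : Matrix.specialUnitaryGroup (Fin N) ℂ) : Matrix (Fin N) (Fin N) ℂ).map (starRingEnd ℂ))) k l *
        (Real.exp (β * ((u : Matrix.specialUnitaryGroup (Fin N) ℂ) : Matrix (Fin N) (Fin N) ℂ).trace.re) : ℂ)
        ∂(haarProbability (Matrix.specialUnitaryGroup (Fin N) ℂ))) =
      ((A • LinearMap.id + B • (Matrix.traceLinearMap (Fin N) ℂ ℂ).smulRight (1 : Matrix (Fin N) (Fin N) ℂ) :
        Module.End ℂ (Matrix (Fin N) (Fin N) ℂ)) (Matrix.single l.1 l.2 1)) k.1 k.2 := by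
    intro k l
    rw [specialUnitary_kroneckerConj_integral_eq_channel hN β k l, ← hM₂, ← hD]
    simp only [hA, hB, LinearMap.add_apply, LinearMap.smul_apply, LinearMap.id_apply, LinearMap.smulRight_apply,
      Matrix.traceLinearMap_apply, Matrix.add_apply, Matrix.smul_apply, smul_eq_mul]
  rw [trace_pow_eq_sum_channel_pow_single _ _ (fun k l => by rw [Matrix.of_apply]; exact hS k l) n]
  simp_rw [conjChannel_linearMap_pow_apply, sum_conjChannel_iterate_single]
  have hN0 : (N : ℂ) ≠ 0 := Nat.cast_ne_zero.2 (NeZero.ne N)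
  have hAB : A + N * B = (D : ℂ) := by
    rw [hA, hB]; push_cast; field_simp; ring
  rw [hAB]

end OnePlaquette

/-! ## §2. The second moment of the free-boundary `SU(N)` Wilson loop -/

section WilsonLoop

variable {L : ℕ} [NeZero L] {N : ℕ}

/-- The conjugate defining representation `u ↦ ū` of `SU(N)` is continuous. -/
theorem continuous_conj_fundamentalRep (N : ℕ) :
    Continuous (((starRingEnd ℂ).mapMatrix : Matrix (Fin N) (Fin N) ℂ →+* Matrix (Fin N) (Fin N) ℂ).toMonoidHom.comp
      (fundamentalRep (Fin N))) :=
  (continuous_fundamentalRep (Fin N)).matrix_map Complex.continuous_conj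

/-- **THE UNNORMALISED SECOND MOMENT** (`SU(N)`, `N ≥ 2`): `∫ |tr W_{R×T}|² ∏_p e^{−β(N − Re tr U_p)} dHaar^{⊗E}
= e^{−NβRT}·(D^{RT} + (N² − 1)·A^{RT})`. -/
theorem specialUnitary_open_normSq_trace_wilsonLoop_integral_eq (hN : 2 ≤ N) (β : ℝ) (i j : ZMod L)
    {R T : ℕ} (hR : R + 1 ≤ L) (hT : T + 1 ≤ L) :
    ∫ U, ((‖((rectangleHolonomy U ![i, j] 0 1 R T : Matrix.specialUnitaryGroup (Fin N) ℂ) :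
          Matrix (Fin N) (Fin N) ℂ).trace‖ ^ 2 : ℝ) : ℂ) *
        ∏ p ∈ (range R ×ˢ range T).image (fun q : ℕ × ℕ => (![i + q.1, j + q.2] : Site 2 L)),
          (Real.exp (-(β * ((N : ℝ) - ((plaquetteHolonomy U p 0 1 : Matrix.specialUnitaryGroup (Fin N) ℂ) :
            Matrix (Fin N) (Fin N) ℂ).trace.re))) : ℂ)
        ∂(Measure.pi fun _ : Edge 2 L => haarProbability (Matrix.specialUnitaryGroup (Fin N) ℂ)) =
      (Real.exp (-(N * β)) : ℂ) ^ (R * T) *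
        (((∑' q : ℤ, (Matrix.of fun i j : Fin N => besselI (q + (i : ℤ) - (j : ℤ)).natAbs β).det : ℝ) : ℂ) ^ (R * T) +
          ((N : ℂ) ^ 2 - 1) *
            ((((∫ u, (‖((u : Matrix.specialUnitaryGroup (Fin N) ℂ) : Matrix (Fin N) (Fin N) ℂ).trace‖ ^ 2 : ℝ) *
                Real.exp (β * ((u : Matrix.specialUnitaryGroup (Fin N) ℂ) : Matrix (Fin N) (Fin N) ℂ).trace.re)
                ∂(haarProbability (Matrix.specialUnitaryGroup (Fin N) ℂ))) -
                (∑' q : ℤ, (Matrix.of fun i j : Fin N => besselI (q + (i : ℤ) - (j : ℤ)).natAbs β).det)) /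
                ((N : ℝ) ^ 2 - 1) : ℝ) : ℂ) ^ (R * T)) := by
  haveI : NeZero N := ⟨by omega⟩
  have hw : Continuous fun u : Matrix.specialUnitaryGroup (Fin N) ℂ =>
      Real.exp (-(β * ((N : ℝ) - ((u : Matrix.specialUnitaryGroup (Fin N) ℂ) : Matrix (Fin N) (Fin N) ℂ).trace.re))) := by
    fun_prop
  have h := integral_trace_mul_trace_rectangleHolonomy_mul_prod_weight (fundamentalRep (Fin N))
    (((starRingEnd ℂ).mapMatrix : Matrix (Fin N) (Fin N) ℂ →+* Matrix (Fin N) (Fin N) ℂ).toMonoidHom.comp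
      (fundamentalRep (Fin N)))
    (continuous_fundamentalRep (Fin N)) (continuous_conj_fundamentalRep N) hw
    (specialUnitary_wilsonWeight_conj N β) i j hT hR
  have hlhs : ∀ U : GaugeConfig 2 L (Matrix.specialUnitaryGroup (Fin N) ℂ),
      (fundamentalRep (Fin N) (rectangleHolonomy U ![i, j] 0 1 R T)).trace *
        ((((starRingEnd ℂ).mapMatrix : Matrix (Fin N) (Fin N) ℂ →+* Matrix (Fin N) (Fin N) ℂ).toMonoidHom.comp
          (fundamentalRep (Fin N))) (rectangleHolonomy U ![i, j] 0 1 R T)).trace =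
        ((‖((rectangleHolonomy U ![i, j] 0 1 R T : Matrix.specialUnitaryGroup (Fin N) ℂ) :
          Matrix (Fin N) (Fin N) ℂ).trace‖ ^ 2 : ℝ) : ℂ) := by
    intro U
    rw [MonoidHom.comp_apply, RingHom.toMonoidHom_eq_coe, MonoidHom.coe_coe, RingHom.mapMatrix_apply,
      fundamentalRep_apply, trace_map_starRingEnd, Complex.mul_conj, Complex.normSq_eq_norm_sq]
  simp_rw [hlhs] at h
  rw [h]
  have hsplit : ∀ u : Matrix.specialUnitaryGroup (Fin N) ℂ,
      (Real.exp (-(β * ((N : ℝ) - ((u : Matrix.specialUnitaryGroup (Fin N) ℂ) : Matrix (Fin N) (Fin N) ℂ).trace.re))) : ℂ) =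
        (Real.exp (-(N * β)) : ℂ) *
          (Real.exp (β * ((u : Matrix.specialUnitaryGroup (Fin N) ℂ) : Matrix (Fin N) (Fin N) ℂ).trace.re) : ℂ) := by
    intro u; rw [← Complex.ofReal_mul, ← Real.exp_add]; congr 2; ring
  have hM : (Matrix.of fun k l : Fin N × Fin N => ∫ g, (fundamentalRep (Fin N) g ⊗ₖ
      (((starRingEnd ℂ).mapMatrix : Matrix (Fin N) (Fin N) ℂ →+* Matrix (Fin N) (Fin N) ℂ).toMonoidHom.comp
        (fundamentalRep (Fin N))) g) k l *
        (Real.exp (-(β * ((N : ℝ) - ((g : Matrix.specialUnitaryGroup (Fin N) ℂ) : Matrix (Fin N) (Fin N) ℂ).trace.re))) : ℂ)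
        ∂(haarProbability (Matrix.specialUnitaryGroup (Fin N) ℂ))) =
      (Real.exp (-(N * β)) : ℂ) • (Matrix.of fun k l : Fin N × Fin N => ∫ u,
        (((u : Matrix.specialUnitaryGroup (Fin N) ℂ) : Matrix (Fin N) (Fin N) ℂ) ⊗ₖ
          (((u : Matrix.specialUnitaryGroup (Fin N) ℂ) : Matrix (Fin N) (Fin N) ℂ).map (starRingEnd ℂ))) k l *
        (Real.exp (β * ((u : Matrix.specialUnitaryGroup (Fin N) ℂ) : Matrix (Fin N) (Fin N) ℂ).trace.re) : ℂ)
        ∂(haarProbability (Matrix.specialUnitaryGroup (Fin N) ℂ))) := by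
    ext k l
    simp only [Matrix.of_apply, Matrix.smul_apply, smul_eq_mul, MonoidHom.comp_apply, RingHom.toMonoidHom_eq_coe,
      MonoidHom.coe_coe, RingHom.mapMatrix_apply, fundamentalRep_apply, hsplit]
    rw [← integral_const_mul]
    exact integral_congr_ae (ae_of_all _ fun u => by ring)
  rw [hM, smul_pow, Matrix.trace_smul, smul_eq_mul, specialUnitary_trace_kroneckerConj_integral_pow hN β (R * T)]

/-- **THE EXACT SECOND MOMENT OF TWO-DIMENSIONAL `SU(N)` WILSON LOOPS WITH FREE BOUNDARY** (`N ≥ 2`, every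
real `β`, every `R × T` loop with `R + 1 ≤ L`, `T + 1 ≤ L`):
`⟨|tr W_{R×T}|²⟩_β = ∫ |tr W|² ∏_p e^{−β(N−Re tr U_p)} / ∫ ∏_p e^{−β(N−Re tr U_p)} = 1 + (N² − 1)·P_adj(β)^{RT}`,
`P_adj(β) = (M₂/D − 1)/(N² − 1)`, `M₂ = ∫_{SU(N)} |tr u|² e^{βRe tr u} du`, `D = Σ_q det[I_{|q+i−j|}(β)]`. -/
theorem specialUnitary_open_normSq_trace_wilsonLoop_eq (hN : 2 ≤ N) (β : ℝ) (i j : ZMod L) {R T : ℕ}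
    (hR : R + 1 ≤ L) (hT : T + 1 ≤ L) :
    (∫ U, ‖((rectangleHolonomy U ![i, j] 0 1 R T : Matrix.specialUnitaryGroup (Fin N) ℂ) :
          Matrix (Fin N) (Fin N) ℂ).trace‖ ^ 2 *
        ∏ p ∈ (range R ×ˢ range T).image (fun q : ℕ × ℕ => (![i + q.1, j + q.2] : Site 2 L)),
          Real.exp (-(β * ((N : ℝ) - ((plaquetteHolonomy U p 0 1 : Matrix.specialUnitaryGroup (Fin N) ℂ) :
            Matrix (Fin N) (Fin N) ℂ).trace.re)))
        ∂(Measure.pi fun _ : Edge 2 L => haarProbability (Matrix.specialUnitaryGroup (Fin N) ℂ))) /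
      (∫ U, ∏ p ∈ (range R ×ˢ range T).image (fun q : ℕ × ℕ => (![i + q.1, j + q.2] : Site 2 L)),
          Real.exp (-(β * ((N : ℝ) - ((plaquetteHolonomy U p 0 1 : Matrix.specialUnitaryGroup (Fin N) ℂ) :
            Matrix (Fin N) (Fin N) ℂ).trace.re)))
        ∂(Measure.pi fun _ : Edge 2 L => haarProbability (Matrix.specialUnitaryGroup (Fin N) ℂ))) =
      1 + ((N : ℝ) ^ 2 - 1) *
        (((∫ u, (‖((u : Matrix.specialUnitaryGroup (Fin N) ℂ) : Matrix (Fin N) (Fin N) ℂ).trace‖ ^ 2 : ℝ) *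
            Real.exp (β * ((u : Matrix.specialUnitaryGroup (Fin N) ℂ) : Matrix (Fin N) (Fin N) ℂ).trace.re)
            ∂(haarProbability (Matrix.specialUnitaryGroup (Fin N) ℂ))) /
            (∑' q : ℤ, (Matrix.of fun i j : Fin N => besselI (q + (i : ℤ) - (j : ℤ)).natAbs β).det) - 1) /
          ((N : ℝ) ^ 2 - 1)) ^ (R * T) := by
  haveI : NeZero N := ⟨by omega⟩
  set M₂ : ℝ := ∫ u, (‖((u : Matrix.specialUnitaryGroup (Fin N) ℂ) : Matrix (Fin N) (Fin N) ℂ).trace‖ ^ 2 : ℝ) *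
    Real.exp (β * ((u : Matrix.specialUnitaryGroup (Fin N) ℂ) : Matrix (Fin N) (Fin N) ℂ).trace.re)
    ∂(haarProbability (Matrix.specialUnitaryGroup (Fin N) ℂ)) with hM₂
  set D : ℝ := ∑' q : ℤ, (Matrix.of fun i j : Fin N => besselI (q + (i : ℤ) - (j : ℤ)).natAbs β).det with hD
  have hDpos : 0 < D := by
    rw [hD, ← integral_haar_specialUnitaryGroup_fin_exp_mul_trace_re N β]
    exact integral_exp_pos ((by fun_prop : Continuous fun u : Matrix.specialUnitaryGroup (Fin N) ℂ =>
      Real.exp (β * ((u : Matrix.specialUnitaryGroup (Fin N) ℂ) : Matrix (Fin N) (Fin N) ℂ).trace.re)).integrable_of_hasCompactSupport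
        (HasCompactSupport.of_compactSpace _))
  have hN1 : ((N : ℝ) ^ 2 - 1) ≠ 0 := by
    have h2 : (2 : ℝ) ≤ N := by exact_mod_cast hN
    nlinarith
  rw [specialUnitary_open_partitionFunction_eq N β i j hR hT]
  have hnum := specialUnitary_open_normSq_trace_wilsonLoop_integral_eq (L := L) hN β i j hR hT
  rw [← hM₂, ← hD] at hnum
  have hnum' : ∫ U, ‖((rectangleHolonomy U ![i, j] 0 1 R T : Matrix.specialUnitaryGroup (Fin N) ℂ) :
          Matrix (Fin N) (Fin N) ℂ).trace‖ ^ 2 *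
        ∏ p ∈ (range R ×ˢ range T).image (fun q : ℕ × ℕ => (![i + q.1, j + q.2] : Site 2 L)),
          Real.exp (-(β * ((N : ℝ) - ((plaquetteHolonomy U p 0 1 : Matrix.specialUnitaryGroup (Fin N) ℂ) :
            Matrix (Fin N) (Fin N) ℂ).trace.re)))
        ∂(Measure.pi fun _ : Edge 2 L => haarProbability (Matrix.specialUnitaryGroup (Fin N) ℂ)) =
      Real.exp (-(N * β)) ^ (R * T) * (D ^ (R * T) + ((N : ℝ) ^ 2 - 1) * ((M₂ - D) / ((N : ℝ) ^ 2 - 1)) ^ (R * T)) := by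
    apply Complex.ofReal_injective
    rw [← integral_complex_ofReal]
    push_cast
    push_cast at hnum
    rw [← hnum]
  rw [hnum', mul_pow, mul_div_mul_left _ _ (pow_ne_zero _ (Real.exp_pos _).ne')]
  have hDn : D ^ (R * T) ≠ 0 := pow_ne_zero _ hDpos.ne'
  have hx : (M₂ - D) / ((N : ℝ) ^ 2 - 1) / D = (M₂ / D - 1) / ((N : ℝ) ^ 2 - 1) := by
    field_simp
  rw [add_div, div_self hDn, mul_div_assoc, ← div_pow, hx]


/-- **Sanity at `β = 0`** (pure Haar links, `SU(N)`, `N ≥ 2`, `RT ≥ 1`): `⟨|tr W_{R×T}|²⟩₀ = 1` — `M₂(0) = ∫_{SU(N)}|tr u|² = 1`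
(the tree's `TrivializingMaps.integral_normSq_trace`) and `D(0) = Σ_q det[I_{|q+i−j|}(0)] = 1`. -/
theorem specialUnitary_open_normSq_trace_wilsonLoop_eq_one (hN : 2 ≤ N) (i j : ZMod L) {R T : ℕ}
    (hR : R + 1 ≤ L) (hT : T + 1 ≤ L) (hRT : 0 < R * T) :
    (∫ U, ‖((rectangleHolonomy U ![i, j] 0 1 R T : Matrix.specialUnitaryGroup (Fin N) ℂ) :
          Matrix (Fin N) (Fin N) ℂ).trace‖ ^ 2 *
        ∏ p ∈ (range R ×ˢ range T).image (fun q : ℕ × ℕ => (![i + q.1, j + q.2] : Site 2 L)),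
          Real.exp (-((0 : ℝ) * ((N : ℝ) - ((plaquetteHolonomy U p 0 1 : Matrix.specialUnitaryGroup (Fin N) ℂ) :
            Matrix (Fin N) (Fin N) ℂ).trace.re)))
        ∂(Measure.pi fun _ : Edge 2 L => haarProbability (Matrix.specialUnitaryGroup (Fin N) ℂ))) /
      (∫ U, ∏ p ∈ (range R ×ˢ range T).image (fun q : ℕ × ℕ => (![i + q.1, j + q.2] : Site 2 L)),
          Real.exp (-((0 : ℝ) * ((N : ℝ) - ((plaquetteHolonomy U p 0 1 : Matrix.specialUnitaryGroup (Fin N) ℂ) :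
            Matrix (Fin N) (Fin N) ℂ).trace.re)))
        ∂(Measure.pi fun _ : Edge 2 L => haarProbability (Matrix.specialUnitaryGroup (Fin N) ℂ))) = 1 := by
  haveI : NeZero N := ⟨by omega⟩
  rw [specialUnitary_open_normSq_trace_wilsonLoop_eq (L := L) hN 0 i j hR hT, tsum_det_besselI_shift_zero]
  have hM2 : (∫ u, (‖((u : Matrix.specialUnitaryGroup (Fin N) ℂ) : Matrix (Fin N) (Fin N) ℂ).trace‖ ^ 2 : ℝ) *
      Real.exp (0 * ((u : Matrix.specialUnitaryGroup (Fin N) ℂ) : Matrix (Fin N) (Fin N) ℂ).trace.re)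
      ∂(haarProbability (Matrix.specialUnitaryGroup (Fin N) ℂ))) = 1 := by
    simp_rw [zero_mul, Real.exp_zero, mul_one, ← Complex.normSq_eq_norm_sq]
    exact Summit.Ventures.LatticeQCDFlow.TrivializingMaps.integral_normSq_trace (by omega)
  rw [hM2, div_one, sub_self, zero_div, zero_pow hRT.ne', mul_zero, add_zero]

end WilsonLoop

end Summit.Ventures.LatticeQCDFlow.Scoring
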